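import Summits.CriticalPhenomena.PercolationContinuityZ3.Theorems.Transplant.FKConnectivityAllQAntipodalTwoSpineRuleR2
import Summits.CriticalPhenomena.PercolationContinuityZ3.Theorems.Transplant.FKConnectivityAllQAntipodalTwoSpinePhiInj
import HarnessLib

/-!
# Connectivity correlation inequalities for `φ_{w,q}` — TWO-SPINE word model: NO SLOT IS USED TWICE by the atom moves (R2 injectivity)

Helper file (`--supports stmt-CriticalPhenomena-4575`), FK sub-lane `prim-bschramm-fk-2` (gen 15); builds on p205010 (kernel theorem,
internal audit signed; external expert review pending).  No named facts, no sorries, standard axioms.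

Memo `bschramm/FROM-fk-2-g15-TWO-SPINE.md` §12 (V2): `tgtA0` (Theorem U on `A∖y`, identity branch on `α` conducting) and `tgtA1` (gen 13's `ι`,
identity branch on X2-neutral words) are injective on the present-side words of critical losers — the identity branches never meet the images
(a `Φ`-image has `ᾱ` non-conducting; a neutral word is not an X2-winner) — and the row exchange of the ground side is injective.  Hence, together
with `cellDelB_swap` and the Janus value, every atom slot of a winner receives at most one piece (the row exchange of the ground side is injective: `map_swapLetter_injective`).
[cite: Grimmett2006, §3.9 (p. 63)]
-/

noncomputable section

namespace Summit.CriticalPhenomena.PercolationContinuityZ3.Theorems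

namespace FK

namespace TwoSpine

open X2Word

/-! ### No slot is used twice by the atom moves (injectivity of the R2 targets, memo §12 V2) -/

/-- `tgtA0` is injective on present-side words of critical losers (`ᾱ` conducting). [folklore] -/
theorem tgtA0_injective {u₁ u₂ : List SLetter} (h₁ : rowC (sRowB u₁) = true) (h₂ : rowC (sRowB u₂) = true)
    (h : tgtA0 u₁ = tgtA0 u₂) : u₁ = u₂ := by
  unfold tgtA0 at h
  rcases Bool.eq_false_or_eq_true (rowC (sRowA u₁)) with a₁ | a₁ <;>
    rcases Bool.eq_false_or_eq_true (rowC (sRowA u₂)) with a₂ | a₂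
  · rwa [if_pos a₁, if_pos a₂] at h
  · -- `u₁ = Φ(u₂)`: but `Φ`-images have `ᾱ` non-conducting
    rw [if_pos a₁, if_neg (by simp [a₂])] at h
    have := (rowC_phiDel a₂ h₂).2
    rw [← h, h₁] at this; exact absurd this (by simp)
  · rw [if_neg (by simp [a₁]), if_pos a₂] at h
    have := (rowC_phiDel a₁ h₁).2
    rw [h, h₂] at this; exact absurd this (by simp)
  · rw [if_neg (by simp [a₁]), if_neg (by simp [a₂])] at h
    have t₁ : topComp (false, false) u₁ = (false, true) := by rw [topComp_deleted, a₁, h₁]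
    have t₂ : topComp (false, false) u₂ = (false, true) := by rw [topComp_deleted, a₂, h₂]
    exact phiRun_injective t₁ (phiReachesRoot_deleted u₁) t₂ (phiReachesRoot_deleted u₂) h

/-- `tgtA1` is injective on present-side words of critical losers with `δ(α) = 1`. [folklore] -/
theorem tgtA1_injective {u₁ u₂ : List SLetter} (h₁ : rowC (sRowB u₁) = true) (d₁ : rowDel (sRowA u₁) = 1)
    (h₂ : rowC (sRowB u₂) = true) (d₂ : rowDel (sRowA u₂) = 1) (h : tgtA1 u₁ = tgtA1 u₂) : u₁ = u₂ := by
  -- X2-loser unless neutral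
  have loser : ∀ {u : List SLetter}, rowC (sRowB u) = true → rowDel (sRowA u) = 1 →
      ¬ ((rowC (sRowA u) && (rowDel (sRowB u) == 1)) = true) → sIsLoser u = true := by
    intro u hb hd hn
    rw [sIsLoser_iff]; simp only [Bool.and_eq_true, beq_iff_eq, Bool.not_eq_true']
    exact ⟨⟨hb, hd⟩, by simpa using hn⟩
  -- a neutral word is not an X2-winner
  have neutral_not_winner : ∀ {u : List SLetter}, rowC (sRowB u) = true → rowDel (sRowA u) = 1 → sIsWinner u = false := by
    intro u hb hd
    rw [sIsWinner_iff]; simp [hb, hd]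
  unfold tgtA1 at h
  by_cases n₁ : (rowC (sRowA u₁) && (rowDel (sRowB u₁) == 1)) = true <;>
    by_cases n₂ : (rowC (sRowA u₂) && (rowDel (sRowB u₂) == 1)) = true
  · rwa [if_pos n₁, if_pos n₂] at h
  · rw [if_pos n₁, if_neg n₂] at h
    have hw := (sigma_wordHall u₂ (loser h₂ d₂ n₂)).1
    rw [← h, neutral_not_winner h₁ d₁] at hw; exact absurd hw (by simp)
  · rw [if_neg n₁, if_pos n₂] at h
    have hw := (sigma_wordHall u₁ (loser h₁ d₁ n₁)).1
    rw [h, neutral_not_winner h₂ d₂] at hw; exact absurd hw (by simp)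
  · rw [if_neg n₁, if_neg n₂] at h
    exact (sigma_wordHall u₂ (loser h₂ d₂ n₂)).2.2.2 u₁ (loser h₁ d₁ n₁) h


end TwoSpine

end FK

end Summit.CriticalPhenomena.PercolationContinuityZ3.Theorems
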